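import Summits.AtomisticToContinuum.HydrodynamicLimit.Theses.AdiabaticParcels

/-!
# Crux `DensityLimit` (stmt-AtomisticToContinuum-17799) — birth skeleton (BC3), line `birth`

Route `route-AtomisticToContinuum-AdiabaticParcels`, sub-problem `HydrodynamicLimit`, crux rank 6:
`Summit.AtomisticToContinuum.HydrodynamicLimit.Theses.AdiabaticParcels.DensityLimit` — THE DENSITY THIRD OF
THE PACKING-GUARDED CONJUNCT (`∃ η₀ > 0 ∀` continuous profiles `∃ σ₀ ∀ σ < σ₀ ∀` classical hs-Euler solutions on
`[0,T)` with `ρ_t(x)σ³ < η₀` throughout `∀` flows with probability local Gibbs laws whose fields converge at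
`t = 0`: at every `t < T` the empirical DENSITY field tested against every continuous `χ` converges in
probability to `∫ χ ρ_t`). The crux is FIXED and concluded BY NAME below.

## The seam: kinematics (open) ∣ the continuity equation (free)

This file registers the route's own declared layer-2 decomposition of the crux (route header, TWO-LAYER PLAN:
"DensityLimit ⇐ MomentumLimit → DensityFromMomentum → DensityLimit (k = 2, rev 18)"; crux docstring
"[deps: MomentumLimit, DensityFromMomentum]") as two registered stubs, each a route item imported BY NAME
(so a restatement of either item by a later `route edit` cannot silently desynchronise this skeleton):

* `stub_momentumLimit` — the route's typed TARGET `MomentumLimit` (item stmt-AtomisticToContinuum-17400,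
  kind crux, rank 0; size XL, open problem; HARDEST, load-bearing): the packing-guarded law of large numbers for
  the empirical MOMENTUM field at every `t < T`. Why it might fail (item's own line): it is the kinematic
  two-thirds of the conjunct — it needs the momentum-flux closure `Π → ρu⊗u + p𝟙` along the deterministic flow
  at fixed reduced density; no mixing theorem exists (Spohn1991 I.3). The route attacks it through the piston
  chain `PistonCellAdiabat → WallTransparency → … → MomentumLimit` (support `MomentumViaPistons`).
* `stub_densityFromMomentum` — the route's support `DensityFromMomentum` (item stmt-AtomisticToContinuum-11910,
  rank 9; size M, grounded NEW AS STATED / PROVABLE NOW; guard-free, every `σ > 0`): IF the momentum field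
  converges at every `s ∈ [0,T)` THEN the density field converges at every `t ∈ [0,T)`. Mechanism: the
  microscopic continuity equation is an IDENTITY along hard-sphere trajectories — positions are continuous and
  piecewise free, so for smooth `ψ`, `⟨ρ_N(t),ψ⟩ − ⟨ρ_N(0),ψ⟩ = ∫₀ᵗ Σᵢ ⟨m_N(s), ∂ᵢψ⟩ᵢ ds` on the good set of
  the flow (LANDED: `Summit.AtomisticToContinuum.HydrodynamicLimit.Theorems.sum_apply_fst_sub_eq_integral`,
  `…sum_empiricalMomentumField_partialDeriv_apply`, `…massContinuity_proof` in
  `Theorems/AnnealedZeroHorizonMassContinuity.lean`); momentum convergence at each `s` + tightness of the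
  kinetic energy per particle (energy field at `0`, conservation) + dominated convergence in `s` give
  `∫₀ᵗ∫ ρ u·∇ψ`, which is `∫ψρ_t − ∫ψρ_0` by the Euler mass equation (`IsHardSphereEulerSolution.mass`, torus
  integration by parts `Torus.integral_inner_gradient_eq_neg_integral_mul_divergence_holds`); continuous `χ`
  by uniform approximation (total empirical mass is `1`). Chore: joint measurability of `(s,z) ↦ flow s z`.

`DensityLimit_of : MomentumLimit → DensityFromMomentum → DensityLimit` is the sorry-free composition (pure
logic: `η₀ := η_ML`; for fixed profiles `σ₀ := σ_ML`; for `σ < σ₀`, a guarded solution, flows with probability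
local Gibbs laws and converging time-0 fields, `MomentumLimit` gives the momentum field at every `s < T` and
`DensityFromMomentum` — guard-free, so it applies at this `σ` verbatim — turns it into the density field at
every `t < T`). Its statement is literally the body of the route's layer-2 glue item `DensityViaMomentum`
(stmt-AtomisticToContinuum-17800); both hypotheses are `@[route_item]` decls of the route (admissible
obligations of the skeleton audit), and they are exactly the statements of the two stubs.

SHARPER CUT, RECORDED NOT REGISTERED (planner remark): the density third consumes from X only the
TIME-INTEGRATED LONGITUDINAL current — for smooth `ψ` the pathwise identity above makes
`⟨ρ_N(t),ψ⟩ − ⟨ρ_N(0),ψ⟩` EQUAL to `∫₀ᵗ Σᵢ⟨m_N(s),∂ᵢψ⟩ᵢ ds`, so `DensityLimit` is equivalent (modulo the landed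
identity, the Euler mass equation and density approximation) to the LLN for `∫₀ᵗ ⟨m_N(s), ∇ψ⟩ ds → ∫₀ᵗ∫ρu·∇ψ`
(gradient test fields only, time-averaged); the solenoidal part of `ρu` and pointwise-in-time convergence are
NOT needed. This is why the crux "stands and falls with X" only in the direction X ⇒ crux; a refutation of the
crux refutes the conjunct directly (conjunct ⇒ DensityLimit by dropping two field clauses).

BC3 probes (planner folder `bc/DensityLimit_probes.lean`, `bc/DensityLimit_probes_converse.lean`): for each
stub, `stub → DensityLimit` and `stub → _root_.HydrodynamicLimit` by
`first | exact? | simpa [stub] | (unfold stub; simpa) | aesop` FAIL (neither stub is cheaply the crux or the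
summit: `MomentumLimit` speaks of the momentum field only, `DensityFromMomentum` is a guard-free conditional).
Disproof used: none on file (`ledger crux ls stmt-AtomisticToContinuum-17799`: no workfiles, no `Disproof.lean`,
no `Negative/` lemmas at registration). Negatives index: no refuted statement of the summit concerns the
density-field LLN (the crux keeps the conjunct's packing guard and the `∀ N, IsProbabilityMeasure` clause, so
the empty-horizon / junk-EOS / `N = 0` witnesses recorded against other routes have no purchase).
Sources: Spohn1991 Part I Ch. 3 §3.2–3.3 (microscopic conservation laws; (3.3)–(3.6)); OllaVaradhanYau1993 §1.
-/

namespace Summit.AtomisticToContinuum.HydrodynamicLimit.Cruxes.DensityLimit.Birth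

/-- STUB 1 · THE MOMENTUM LIMIT X (route target `MomentumLimit`, item stmt-AtomisticToContinuum-17400, BY
NAME; size XL; HARDEST — the load-bearing open input of the line): packing-guarded LLN for the empirical
momentum field at every `t < T` along classical hs-Euler solutions, from local Gibbs data at fixed reduced
density. Leans on: `Literature.MathematicalPhysics.KineticTheory.IsHardSphereEulerSolution`,
`…localGibbsLaw`, `…empiricalMomentumField`, `…TendstoHydroFieldsAt`, `Literature.Analysis.FluidPDE.HardSphereFlow`. -/
theorem stub_momentumLimit :
    Summit.AtomisticToContinuum.HydrodynamicLimit.Theses.AdiabaticParcels.MomentumLimit := by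
  sorry

/-- STUB 2 · THE CONTINUITY EQUATION IS FREE (route support `DensityFromMomentum`, item
stmt-AtomisticToContinuum-11910, BY NAME; size M; provable now — pathwise mass identity along hard-sphere
trajectories (landed, `Theorems/AnnealedZeroHorizonMassContinuity.lean`) + tightness of kinetic energy per
particle + dominated convergence in `s` + Euler mass equation + uniform approximation of continuous `χ`):
for every `σ > 0`, momentum-field convergence at every `s ∈ [0,T)` implies density-field convergence at every
`t ∈ [0,T)`. -/
theorem stub_densityFromMomentum :
    Summit.AtomisticToContinuum.HydrodynamicLimit.Theses.AdiabaticParcels.DensityFromMomentum := by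
  sorry

/-! ## The composition: the two stubs conclude the crux BY NAME (real proof, no `sorry`) -/

/-- **`DensityLimit` from the line** — pure logic over the two stub statements (= the route items
`MomentumLimit`, `DensityFromMomentum` by name): `η₀ := η_ML`, `σ₀ := σ_ML` for the given profiles; at
`σ < σ₀` the guarded solution, the flows, the probability local Gibbs laws and the converging time-0 fields
feed `MomentumLimit` (momentum field at every `s < T`) and then the guard-free `DensityFromMomentum`
(density field at every `t < T`). Literally the body of the route's glue item `DensityViaMomentum`
(stmt-AtomisticToContinuum-17800). Axioms ⊆ {propext, Classical.choice, Quot.sound}. -/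
theorem DensityLimit_of :
    Summit.AtomisticToContinuum.HydrodynamicLimit.Theses.AdiabaticParcels.MomentumLimit →
      Summit.AtomisticToContinuum.HydrodynamicLimit.Theses.AdiabaticParcels.DensityFromMomentum →
        Summit.AtomisticToContinuum.HydrodynamicLimit.Theses.AdiabaticParcels.DensityLimit := by
  intro hML hDFM
  obtain ⟨η₀, hη₀, H⟩ := hML
  refine ⟨η₀, hη₀, ?_⟩
  intro a₀ θ₀ u₀ ha hθ hu ha0 hθ0
  obtain ⟨σ₀, hσ₀, Hσ⟩ := H a₀ θ₀ u₀ ha hθ hu ha0 hθ0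
  refine ⟨σ₀, hσ₀, ?_⟩
  intro σ hσ hσlt T ρ θ u hE hG Φ hP h0
  exact hDFM σ a₀ θ₀ u₀ hσ T ρ θ u hE Φ hP h0 (Hσ σ hσ hσlt T ρ θ u hE hG Φ hP h0)

/-- Wiring check: the registered stubs feed `DensityLimit_of` exactly as stated (no new `sorry` here; the
only `sorryAx` dependence of this term is through `stub_momentumLimit` / `stub_densityFromMomentum`). -/
example : Summit.AtomisticToContinuum.HydrodynamicLimit.Theses.AdiabaticParcels.DensityLimit :=
  DensityLimit_of stub_momentumLimit stub_densityFromMomentum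

end Summit.AtomisticToContinuum.HydrodynamicLimit.Cruxes.DensityLimit.Birth
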